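import Literature.NumberTheory.QuadraticFields.ThreeTorsionMeanSquarefreeDensity
import Literature.NumberTheory.LFunctions.TaoLogChowlaMoebiusOfLiouville
import HarnessLib

/-!
# Squarefree integers in a residue class `c (mod L)`: main term `+ O(√N)`

The elementary count behind "the number of quadratic fields with discriminant in an arithmetic
progression" (Taniguchi–Thorne 2013, Lemma 21, citing Tenenbaum I.3.7 Thm 9; the `Σ 1` part of
their Theorem 6, §6.1 eq. (6.1)): for `L ≥ 1`, ANY `c`, and an integer interval `[a, b)` not
containing `0` with `|a|, |b| ≤ M`,

`|#{x ∈ [a, b) : x ≡ c (mod L), x squarefree} - ((b - a)/L) ρ(c, L)| ≤ 5 √M`,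
`ρ(c, L) = (6/π²) Π_{p ∣ L} (1 - 𝟙_{G_p ∣ c} G_p/p²)(1 - p⁻²)⁻¹`, `G_p = gcd(L, p²)`

(`abs_card_squarefree_modEq_sub_le'`), and its coprime case `gcd(c, L) = 1`, where all local
factors are `1` (`abs_card_squarefree_modEq_sub_le`). PROVED (folklore): `𝟙_{sqfree}(|x|) =
Σ_{d² ∣ x} μ(d)` (`Literature.NumberTheory.LFunctions.sqfreeInd_eq_sum_moebius`), swap sums;
the conditions `x ≡ c (L)`, `d² ∣ x` are one class mod `lcm(L, d²)` if `gcd(L, d²) ∣ c` (Bézout)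
and incompatible otherwise; classes are counted with error `≤ 1`; `d > √M` contributes nothing;
the tail of the density series (`ThreeTorsionMeanSquarefreeDensity.lean`) beyond `√M` costs
`≤ 4√M`.

## References
* T. Taniguchi, F. Thorne, *Secondary terms in counting functions for cubic fields*, Duke Math. J.
  162 (2013), Lemma 21 and §6.1 [TaniguchiThorne2013].
* G. Tenenbaum, *Introduction to analytic and probabilistic number theory*, I.3.7, Thm 9.
-/

noncomputable section

open Finset Filter
open scoped ArithmeticFunction.Moebius Topology

namespace Literature.NumberTheory.QuadraticFields

open Literature.NumberTheory.LFunctions (sqfreeInd sqfreeInd_eq_sum_moebius)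

/-! ### The squarefree sieve on a finite set of nonzero integers -/

section Sieve

variable [DecidablePred (Squarefree : ℤ → Prop)]

/-- For a finite set `S` of nonzero integers of absolute value `≤ M`:
`#{x ∈ S : x squarefree} = Σ_{1 ≤ d ≤ M} μ(d) · #{x ∈ S : d² ∣ x}` (from
`𝟙_{sqfree}(|x|) = Σ_{d ≤ M, d² ∣ |x|} μ(d)`). [folklore] -/
theorem card_filter_squarefree_eq_sum_moebius (S : Finset ℤ) {M : ℕ}
    (h0 : ∀ x ∈ S, x ≠ 0) (hM : ∀ x ∈ S, x.natAbs ≤ M) :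
    ((S.filter Squarefree).card : ℝ) =
      ∑ d ∈ Icc 1 M, (μ d : ℝ) * ((S.filter (fun x => ((d : ℤ) ^ 2 ∣ x))).card : ℝ) := by
  have h1 : ((S.filter Squarefree).card : ℝ) = ∑ x ∈ S, sqfreeInd x.natAbs := by
    rw [Finset.card_filter, Nat.cast_sum]
    refine Finset.sum_congr rfl fun x _ => ?_
    simp only [sqfreeInd, Int.squarefree_natAbs]
    by_cases hx : Squarefree x <;> simp [hx]
  have h2 : ∀ x ∈ S, sqfreeInd x.natAbs =
      ∑ d ∈ Icc 1 M, (if (d : ℤ) ^ 2 ∣ x then (μ d : ℝ) else 0) := by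
    intro x hx
    rw [sqfreeInd_eq_sum_moebius (Int.natAbs_pos.2 (h0 x hx)) (hM x hx), Finset.sum_filter]
    refine Finset.sum_congr rfl fun d _ => ?_
    have : d ^ 2 ∣ x.natAbs ↔ (d : ℤ) ^ 2 ∣ x := by
      rw [← Int.natCast_dvd, Nat.cast_pow]
    simp only [this]
  rw [h1, Finset.sum_congr rfl h2, Finset.sum_comm]
  refine Finset.sum_congr rfl fun d _ => ?_
  rw [← Finset.sum_filter, Finset.sum_const, nsmul_eq_mul, mul_comm]

end Sieve

/-- If `d² > M` then no nonzero `x` with `|x| ≤ M` is divisible by `d²`. [folklore] -/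
theorem filter_sq_dvd_eq_empty (S : Finset ℤ) {M d : ℕ} (h0 : ∀ x ∈ S, x ≠ 0)
    (hM : ∀ x ∈ S, x.natAbs ≤ M) (hd : M < d ^ 2) :
    S.filter (fun x => ((d : ℤ) ^ 2 ∣ x)) = ∅ := by
  refine Finset.filter_eq_empty_iff.2 fun x hx hdx => ?_
  have h1 : d ^ 2 ∣ x.natAbs := by rw [← Int.natCast_dvd, Nat.cast_pow]; exact hdx
  have h2 : d ^ 2 ≤ x.natAbs := Nat.le_of_dvd (Int.natAbs_pos.2 (h0 x hx)) h1
  exact absurd (hM x hx) (by omega)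

/-! ### Residue classes: `x ≡ c (L)`, `d² ∣ x` is one class mod `lcm(L, d²)` or empty -/

/-- If `gcd(L, d²) ∣ c`, the conditions `x ≡ c (mod L)`, `d² ∣ x` cut out exactly one residue
class modulo `lcm(L, d²)` (Bézout / Chinese remainder theorem). [folklore] -/
theorem exists_modEq_and_sq_dvd_iff' {L d : ℕ} {c : ℤ} (hG : ((Nat.gcd L (d ^ 2) : ℕ) : ℤ) ∣ c) :
    ∃ e : ℤ, ∀ x : ℤ, (x ≡ c [ZMOD L] ∧ (d : ℤ) ^ 2 ∣ x) ↔
      x ≡ e [ZMOD ((Nat.lcm L (d ^ 2) : ℕ) : ℤ)] := by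
  obtain ⟨t, ht⟩ := hG
  have hbez := Nat.gcd_eq_gcd_ab L (d ^ 2)
  set u := Nat.gcdA L (d ^ 2)
  set v := Nat.gcdB L (d ^ 2)
  refine ⟨c - L * (u * t), fun x => ?_⟩
  have hlcm : ((Nat.lcm L (d ^ 2) : ℕ) : ℤ) = Int.lcm (L : ℤ) ((d ^ 2 : ℕ) : ℤ) := by
    simp [Int.lcm]
  rw [hlcm, ← Int.modEq_and_modEq_iff_modEq_lcm]
  have he1 : c - L * (u * t) ≡ c [ZMOD L] :=
    Int.modEq_iff_dvd.2 ⟨u * t, by ring⟩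
  have he2 : ((d ^ 2 : ℕ) : ℤ) ∣ c - L * (u * t) := by
    refine ⟨v * t, ?_⟩
    rw [ht]
    linear_combination t * hbez
  constructor
  · rintro ⟨h1, h2⟩
    refine ⟨h1.trans he1.symm, ?_⟩
    have h2' : ((d ^ 2 : ℕ) : ℤ) ∣ x := by exact_mod_cast h2
    exact (Int.modEq_zero_iff_dvd.2 h2').trans (Int.modEq_zero_iff_dvd.2 he2).symm
  · rintro ⟨h1, h2⟩
    refine ⟨h1.trans he1, ?_⟩
    have h3 : ((d ^ 2 : ℕ) : ℤ) ∣ x :=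
      Int.modEq_zero_iff_dvd.1 (h2.trans (Int.modEq_zero_iff_dvd.2 he2))
    exact_mod_cast h3

/-- If `gcd(L, d²) ∤ c`, then no `x ≡ c (mod L)` is divisible by `d²`. [folklore] -/
theorem not_sq_dvd_of_modEq_of_not_gcd_dvd {L d : ℕ} {c x : ℤ}
    (hG : ¬ ((Nat.gcd L (d ^ 2) : ℕ) : ℤ) ∣ c) (hx : x ≡ c [ZMOD L]) : ¬ (d : ℤ) ^ 2 ∣ x := by
  intro hdx
  apply hG
  have h1 : ((Nat.gcd L (d ^ 2) : ℕ) : ℤ) ∣ x :=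
    (Int.natCast_dvd_natCast.2 (Nat.gcd_dvd_right L (d ^ 2))).trans (by exact_mod_cast hdx)
  have h2 : ((Nat.gcd L (d ^ 2) : ℕ) : ℤ) ∣ c - x :=
    (Int.natCast_dvd_natCast.2 (Nat.gcd_dvd_left L (d ^ 2))).trans (Int.modEq_iff_dvd.1 hx)
  have h := dvd_add h2 h1
  rwa [sub_add_cancel] at h

/-! ### The count -/

section Count

variable [DecidablePred (Squarefree : ℤ → Prop)]

/-- **Squarefree integers in an arbitrary residue class.** For `L ≥ 1`, any `c`, integers
`a ≤ b` with `0 ∉ [a, b)` (`b ≤ 0` or `0 < a`) and `|a|, |b| ≤ M`: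
`|#{x ∈ [a, b) : x ≡ c (mod L), x squarefree} - ((b - a)/L) ρ(c, L)| ≤ 5 √M`, where
`ρ(c, L) = (6/π²) Π_{p ∣ L} (1 - 𝟙_{G_p ∣ c} G_p/p²)(1 - p⁻²)⁻¹`, `G_p = gcd(L, p²)`, i.e. local
factor `1 - 𝟙_{p ∣ c}/p` at `p ∥ L` and `1 - 𝟙_{p² ∣ c}` at `p² ∣ L` (Taniguchi–Thorne's
`e(c, pᵏ)`; Tenenbaum I.3.7 Thm 9 type count; the constant `5` is crude). [folklore] -/
theorem abs_card_squarefree_modEq_sub_le' {L : ℕ} (hL : 0 < L) (c : ℤ)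
    {a b : ℤ} (hab : a ≤ b) (h0 : b ≤ 0 ∨ 0 < a) {M : ℕ} (haM : a.natAbs ≤ M)
    (hbM : b.natAbs ≤ M) :
    |(((Ico a b).filter (fun x => x ≡ c [ZMOD L] ∧ Squarefree x)).card : ℝ)
        - ((b : ℝ) - a) / L * (6 / Real.pi ^ 2 * ∏ p ∈ L.primeFactors,
          (1 - (if ((Nat.gcd L (p ^ 2) : ℕ) : ℤ) ∣ c then ((Nat.gcd L (p ^ 2) : ℕ) : ℝ) / (p : ℝ) ^ 2
            else 0)) * (1 - 1 / (p : ℝ) ^ 2)⁻¹)|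
      ≤ 5 * Real.sqrt M := by
  set S := (Ico a b).filter (fun x => x ≡ c [ZMOD L]) with hS
  set Smain := 6 / Real.pi ^ 2 * ∏ p ∈ L.primeFactors,
    (1 - (if ((Nat.gcd L (p ^ 2) : ℕ) : ℤ) ∣ c then ((Nat.gcd L (p ^ 2) : ℕ) : ℝ) / (p : ℝ) ^ 2
      else 0)) * (1 - 1 / (p : ℝ) ^ 2)⁻¹ with hSmain
  set f : ℕ → ℝ := fun d => (μ d : ℝ) * (if ((Nat.gcd L (d ^ 2) : ℕ) : ℤ) ∣ c then
        ((Nat.gcd L (d ^ 2) : ℕ) : ℝ) / (d : ℝ) ^ 2 else 0) with hf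
  set D₀ := Nat.sqrt M with hD₀
  have hxS : ∀ x ∈ S, x ≠ 0 ∧ x.natAbs ≤ M := by
    intro x hx
    rw [hS, Finset.mem_filter, Finset.mem_Ico] at hx
    obtain ⟨⟨hax, hxb⟩, -⟩ := hx
    refine ⟨?_, ?_⟩
    · rintro rfl; rcases h0 with h | h <;> omega
    · omega
  -- step 1: the sieve identity
  have hcard : (((Ico a b).filter (fun x => x ≡ c [ZMOD L] ∧ Squarefree x)).card : ℝ) =
      ∑ d ∈ Icc 1 M, (μ d : ℝ) * ((S.filter (fun x => ((d : ℤ) ^ 2 ∣ x))).card : ℝ) := by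
    rw [← card_filter_squarefree_eq_sum_moebius S (fun x hx => (hxS x hx).1)
      (fun x hx => (hxS x hx).2), hS, Finset.filter_filter]
  -- step 2: truncate to `d ≤ D₀ = ⌊√M⌋`
  have htrunc : ∑ d ∈ Icc 1 M, (μ d : ℝ) * ((S.filter (fun x => ((d : ℤ) ^ 2 ∣ x))).card : ℝ) =
      ∑ d ∈ Icc 1 D₀, (μ d : ℝ) * ((S.filter (fun x => ((d : ℤ) ^ 2 ∣ x))).card : ℝ) := by
    symm
    refine Finset.sum_subset (fun d hd => ?_) (fun d hdM hdD => ?_)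
    · rw [Finset.mem_Icc] at hd ⊢; exact ⟨hd.1, hd.2.trans (Nat.sqrt_le_self M)⟩
    · rw [Finset.mem_Icc] at hdM hdD
      have hlt : D₀ < d := by omega
      have hMd : M < d ^ 2 := Nat.sqrt_lt'.1 hlt
      rw [filter_sq_dvd_eq_empty S (fun x hx => (hxS x hx).1) (fun x hx => (hxS x hx).2) hMd]
      simp
  -- step 3: termwise comparison for `d ≤ D₀`
  have hterm : ∀ d ∈ Icc 1 D₀,
      |(μ d : ℝ) * ((S.filter (fun x => ((d : ℤ) ^ 2 ∣ x))).card : ℝ)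
        - ((b : ℝ) - a) / L * f d| ≤ 1 := by
    intro d hd
    rw [Finset.mem_Icc] at hd
    by_cases hG : ((Nat.gcd L (d ^ 2) : ℕ) : ℤ) ∣ c
    · obtain ⟨e, he⟩ := exists_modEq_and_sq_dvd_iff' hG
      have hfilt : S.filter (fun x => ((d : ℤ) ^ 2 ∣ x)) =
          (Ico a b).filter (fun x => x ≡ e [ZMOD ((Nat.lcm L (d ^ 2) : ℕ) : ℤ)]) := by
        rw [hS, Finset.filter_filter]
        exact Finset.filter_congr fun x _ => he x
      have hd2 : 0 < d ^ 2 := pow_pos hd.1 2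
      have hlcm_pos : 0 < Nat.lcm L (d ^ 2) := Nat.lcm_pos hL hd2
      have hr : (0 : ℤ) < ((Nat.lcm L (d ^ 2) : ℕ) : ℤ) := by exact_mod_cast hlcm_pos
      have hcount := abs_card_Ico_filter_modEq_sub_le hab hr e
      have hgl : ((Nat.gcd L (d ^ 2) : ℕ) : ℝ) * ((Nat.lcm L (d ^ 2) : ℕ) : ℝ) =
          (L : ℝ) * (d : ℝ) ^ 2 := by
        have := Nat.gcd_mul_lcm L (d ^ 2)
        exact_mod_cast this
      have hGpos : (0 : ℝ) < ((Nat.gcd L (d ^ 2) : ℕ) : ℝ) := by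
        exact_mod_cast Nat.gcd_pos_of_pos_left _ hL
      have hlcmR : (0 : ℝ) < ((Nat.lcm L (d ^ 2) : ℕ) : ℝ) := by exact_mod_cast hlcm_pos
      rw [hfilt]
      simp only [hf, if_pos hG]
      have hμ : |((μ d : ℤ) : ℝ)| ≤ 1 := by
        rw [← Int.cast_abs]; exact_mod_cast ArithmeticFunction.abs_moebius_le_one
      have hd0 : (d : ℝ) ≠ 0 := by exact_mod_cast (show d ≠ 0 by omega)
      have hL0 : (L : ℝ) ≠ 0 := by exact_mod_cast hL.ne'
      -- `(b - a)/L · G/d² = (b - a)/lcm`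
      have hratio : ((b : ℝ) - a) / L * (((Nat.gcd L (d ^ 2) : ℕ) : ℝ) / (d : ℝ) ^ 2) =
          ((b : ℝ) - a) / ((Nat.lcm L (d ^ 2) : ℕ) : ℝ) := by
        rw [eq_div_iff hlcmR.ne']
        field_simp
        linear_combination ((b : ℝ) - a) * hgl
      have key : (μ d : ℝ) * (((Ico a b).filter
            (fun x => x ≡ e [ZMOD ((Nat.lcm L (d ^ 2) : ℕ) : ℤ)])).card : ℝ)
          - ((b : ℝ) - a) / L * ((μ d : ℝ) * (((Nat.gcd L (d ^ 2) : ℕ) : ℝ) / (d : ℝ) ^ 2)) =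
          (μ d : ℝ) * ((((Ico a b).filter
            (fun x => x ≡ e [ZMOD ((Nat.lcm L (d ^ 2) : ℕ) : ℤ)])).card : ℝ)
            - ((b : ℝ) - a) / (((Nat.lcm L (d ^ 2) : ℕ) : ℤ) : ℝ)) := by
        rw [Int.cast_natCast, ← hratio]; ring
      rw [key, abs_mul]
      calc |((μ d : ℤ) : ℝ)| * |((((Ico a b).filter
            (fun x => x ≡ e [ZMOD ((Nat.lcm L (d ^ 2) : ℕ) : ℤ)])).card : ℝ)
            - ((b : ℝ) - a) / (((Nat.lcm L (d ^ 2) : ℕ) : ℤ) : ℝ))|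
          ≤ 1 * 1 := mul_le_mul hμ hcount (abs_nonneg _) zero_le_one
        _ = 1 := one_mul 1
    · have hempty : S.filter (fun x => ((d : ℤ) ^ 2 ∣ x)) = ∅ := by
        refine Finset.filter_eq_empty_iff.2 fun x hx => ?_
        rw [hS, Finset.mem_filter] at hx
        exact not_sq_dvd_of_modEq_of_not_gcd_dvd hG hx.2
      rw [hempty]
      simp [hf, hG]
  -- step 4: the termwise errors add up to at most `D₀`
  have hE1 : |∑ d ∈ Icc 1 D₀, (μ d : ℝ) * ((S.filter (fun x => ((d : ℤ) ^ 2 ∣ x))).card : ℝ)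
      - ((b : ℝ) - a) / L * ∑ d ∈ Icc 1 D₀, f d| ≤ D₀ := by
    rw [Finset.mul_sum, ← Finset.sum_sub_distrib]
    refine (Finset.abs_sum_le_sum_abs _ _).trans ?_
    refine (Finset.sum_le_sum hterm).trans ?_
    simp
  -- step 5: `Σ_{1 ≤ d ≤ D₀} f = Σ_{d < D₀ + 1} f` and the tail of the series
  have hIcc : ∑ d ∈ Icc 1 D₀, f d = ∑ d ∈ range (D₀ + 1), f d := by
    rw [Finset.range_eq_Ico, Finset.sum_eq_sum_Ico_succ_bot (Nat.succ_pos D₀),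
      ← Finset.Ico_add_one_right_eq_Icc]
    have hf0 : f 0 = 0 := by simp [hf]
    rw [hf0, zero_add]
    rfl
  have htail : |Smain - ∑ d ∈ range (D₀ + 1), f d| ≤ (2 : ℝ) * L / ((D₀ + 1 : ℕ) : ℝ) :=
    abs_sub_sum_range_moebius_gcdWeight_le hL c (Nat.succ_pos D₀)
  -- step 6: sizes: `D₀ ≤ √M`, `√M ≤ D₀ + 1`, `b - a ≤ 2M`
  have hD₀le : (D₀ : ℝ) ≤ Real.sqrt M := by
    have h1 : ((D₀ ^ 2 : ℕ) : ℝ) ≤ M := by exact_mod_cast Nat.sqrt_le' M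
    have h2 : (D₀ : ℝ) = Real.sqrt ((D₀ : ℝ) ^ 2) := (Real.sqrt_sq (Nat.cast_nonneg _)).symm
    rw [h2]
    exact Real.sqrt_le_sqrt (by exact_mod_cast h1)
  have hD₀ge : Real.sqrt M ≤ (D₀ : ℝ) + 1 := by
    have h1 : (M : ℝ) ≤ (((D₀ + 1) ^ 2 : ℕ) : ℝ) := by exact_mod_cast (Nat.lt_succ_sqrt' M).le
    have h2 : (D₀ : ℝ) + 1 = Real.sqrt (((D₀ : ℝ) + 1) ^ 2) := (Real.sqrt_sq (by positivity)).symm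
    rw [h2]
    exact Real.sqrt_le_sqrt (by exact_mod_cast h1)
  have hba0 : 0 ≤ (b : ℝ) - a := by
    have : (a : ℝ) ≤ b := by exact_mod_cast hab
    linarith
  have hBA2 : ((b : ℝ) - a) ≤ 2 * M := by
    have ha : -a ≤ (M : ℤ) := by omega
    have hb : b ≤ (M : ℤ) := by omega
    have ha' : -(a : ℝ) ≤ M := by exact_mod_cast ha
    have hb' : (b : ℝ) ≤ M := by exact_mod_cast hb
    linarith
  have hL1 : (1 : ℝ) ≤ L := by exact_mod_cast hL
  have hLpos : (0 : ℝ) < L := by positivity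
  -- step 7: combine
  have hM0 : (0 : ℝ) ≤ Real.sqrt M := Real.sqrt_nonneg _
  rw [hcard, htrunc]
  have hsplit : ∑ d ∈ Icc 1 D₀, (μ d : ℝ) * ((S.filter (fun x => ((d : ℤ) ^ 2 ∣ x))).card : ℝ)
        - ((b : ℝ) - a) / L * Smain =
      (∑ d ∈ Icc 1 D₀, (μ d : ℝ) * ((S.filter (fun x => ((d : ℤ) ^ 2 ∣ x))).card : ℝ)
        - ((b : ℝ) - a) / L * ∑ d ∈ Icc 1 D₀, f d)
      - ((b : ℝ) - a) / L * (Smain - ∑ d ∈ range (D₀ + 1), f d) := by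
    rw [hIcc]; ring
  rw [hsplit]
  refine (abs_sub _ _).trans ?_
  have hsecond : |((b : ℝ) - a) / L * (Smain - ∑ d ∈ range (D₀ + 1), f d)| ≤
      4 * Real.sqrt M := by
    rw [abs_mul, abs_of_nonneg (div_nonneg hba0 hLpos.le)]
    have hD1 : (0 : ℝ) < (D₀ : ℝ) + 1 := by positivity
    calc ((b : ℝ) - a) / L * |Smain - ∑ d ∈ range (D₀ + 1), f d|
        ≤ ((b : ℝ) - a) / L * ((2 : ℝ) * L / ((D₀ : ℝ) + 1)) := by
          refine mul_le_mul_of_nonneg_left ?_ (div_nonneg hba0 hLpos.le)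
          have := htail; push_cast at this; exact this
      _ = 2 * (((b : ℝ) - a) / ((D₀ : ℝ) + 1)) := by field_simp
      _ ≤ 2 * (2 * M / ((D₀ : ℝ) + 1)) := by gcongr
      _ = 4 * (M / ((D₀ : ℝ) + 1)) := by ring
      _ ≤ 4 * Real.sqrt M := by
          refine mul_le_mul_of_nonneg_left ?_ (by norm_num)
          rw [div_le_iff₀ hD1]
          calc (M : ℝ) = Real.sqrt M * Real.sqrt M := (Real.mul_self_sqrt (Nat.cast_nonneg _)).symm
            _ ≤ Real.sqrt M * ((D₀ : ℝ) + 1) := mul_le_mul_of_nonneg_left hD₀ge hM0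
  linarith [hE1, hsecond, hD₀le]

/-- **Squarefree integers in a coprime residue class.** For `L ≥ 1`, `gcd(c, L) = 1`, integers
`a ≤ b` with `0 ∉ [a, b)` and `|a|, |b| ≤ M`:
`|#{x ∈ [a, b) : x ≡ c (mod L), x squarefree} - ((b - a)/L) (6/π²) Π_{p ∣ L} (1 - p⁻²)⁻¹| ≤ 5 √M`
(all local factors of `abs_card_squarefree_modEq_sub_le'` are `1`). [folklore] -/
theorem abs_card_squarefree_modEq_sub_le {L : ℕ} (hL : 0 < L) {c : ℤ} (hc : Int.gcd c L = 1)
    {a b : ℤ} (hab : a ≤ b) (h0 : b ≤ 0 ∨ 0 < a) {M : ℕ} (haM : a.natAbs ≤ M)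
    (hbM : b.natAbs ≤ M) :
    |(((Ico a b).filter (fun x => x ≡ c [ZMOD L] ∧ Squarefree x)).card : ℝ)
        - ((b : ℝ) - a) / L * (6 / Real.pi ^ 2 * ∏ p ∈ L.primeFactors, (1 - 1 / (p : ℝ) ^ 2)⁻¹)|
      ≤ 5 * Real.sqrt M := by
  have h := abs_card_squarefree_modEq_sub_le' hL c hab h0 haM hbM
  have hloc : ∀ p ∈ L.primeFactors, ¬ ((Nat.gcd L (p ^ 2) : ℕ) : ℤ) ∣ c := by
    intro p hp hdvd
    have hpP := Nat.prime_of_mem_primeFactors hp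
    have hpG : p ∣ Nat.gcd L (p ^ 2) := Nat.dvd_gcd (Nat.dvd_of_mem_primeFactors hp) (dvd_pow_self p two_ne_zero)
    have hpc : (p : ℤ) ∣ c := (Int.natCast_dvd_natCast.2 hpG).trans hdvd
    have hp1 : p ∣ Int.gcd c L := by
      rw [Int.gcd_eq_natAbs, Int.natAbs_natCast]
      exact Nat.dvd_gcd (Int.natCast_dvd.1 hpc) (Nat.dvd_of_mem_primeFactors hp)
    rw [hc] at hp1
    exact hpP.one_lt.ne' (Nat.dvd_one.1 hp1)
  have hprod : ∏ p ∈ L.primeFactors,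
      (1 - (if ((Nat.gcd L (p ^ 2) : ℕ) : ℤ) ∣ c then ((Nat.gcd L (p ^ 2) : ℕ) : ℝ) / (p : ℝ) ^ 2
        else 0)) * (1 - 1 / (p : ℝ) ^ 2)⁻¹ = ∏ p ∈ L.primeFactors, (1 - 1 / (p : ℝ) ^ 2)⁻¹ :=
    Finset.prod_congr rfl fun p hp => by rw [if_neg (hloc p hp), sub_zero, one_mul]
  rwa [hprod] at h

end Count

end Literature.NumberTheory.QuadraticFields

end
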